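import Summits.BirchSwinnertonDyer.BirchSwinnertonDyer.Theorems.ManinLocalTwoThreeManinPrimeToAdditiveFiveLeReducibleResidueThirteen
import HarnessLib

/-!
# Route `ManinLocalTwoThree`, residual crux C5 `ManinPrimeToAdditiveFiveLe`
# (stmt-BirchSwinnertonDyer-22969), line `upper_anchor`: RED(13) cut by Cremona's table to `N > 5·10⁵`,
# and STUB 2 `stub_reducibleTwistMinimal` ⟸ Edixhoven Thm. 3 ∧ ČNS Thm. 1.2 ∧ Cremona ∧ Mazur's list ∧ RED(57) ∧ RED(13♯)

Sequel of `…ReducibleResidueThirteen.lean` (lead seat `bsd-line-ml23-c5-p1`, gen 2). (1) `coreRED13_of_cremona_of_coreRED13sharp`: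
core RED(13) (`p = 13`, `W[13]` reducible, globally twist-minimal, `ord₁₃ Δ_min ≤ 4`, (G)-ordinary,
`13 ∣ deg φ`, lattice-optimal conductor-level datum) follows from RED(13♯) = the same binders PLUS
`500000 < N(W)`, GRANTED Cremona's table (cite-only fact `cremona_abs_maninConstant_eq_one_of_level_le_500000`:
`|c| = 1` at every lattice-optimal datum of level `≤ 5·10⁵`) — RED(11)/RED(13) never carried the Cremona cut,
which the line's ledger theorem already has among its hypotheses. In Cremona's range RED(13) consists of
exactly the classes `366054cc`, `366054bk` (lead's evidence #6/#11), so RED(13♯) is EMPTY there; beyond it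
RED(13♯) is the (infinite) `X₀(13)` family with `13² ∣ N > 5·10⁵`, Kodaira II/III/IV, `j ≢ 5 (mod 13)`,
`13 ∣ deg φ`. (2) `reducibleTwistMinimal_of_print_mazurJ_of_cores`: the registered stub
`stub_reducibleTwistMinimal` of the line skeleton `Cruxes/ManinPrimeToAdditiveFiveLe/Lines/upper_anchor.lean`
(signature VERBATIM as the conclusion) from the width seat's `reducibleTwistMinimal_of_edixhoven_cns_of_cores`
(p608852: stub 2 ⟸ EdK ∧ EdG ∧ ČNS ∧ RED(57) ∧ RED(11)) with RED(11) cut to RED(13) by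
`coreRED11_of_mazurJ_of_coreRED13` (Mazur 1978 Thm. 1 + the rational points of `X₀(p)`, cite-only fact
`Literature.NumberTheory.EllipticCurves.mazur_j_mem_of_not_hasIrreducibleModPGaloisRep_of_eleven_le`) and
RED(13) cut to RED(13♯) by (1).

HONEST STATUS. Conditional-result (`--supports … --as helper`); the registered stub stays `sorry` in the
skeleton (its inputs EdK, EdG, ČNS, Cremona, MazurJ are cite-only printed facts NOT among C5's hypotheses, and
RED(57), RED(13♯) are OPEN). Nothing here proves BSD, Manin's conjecture or C5.
-/

set_option autoImplicit false
-- the Theorems namespace of this sub repeats the summit name by design (D-0017 nested layout)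
set_option linter.dupNamespace false

noncomputable section

open scoped Classical NumberField

namespace Summit.BirchSwinnertonDyer.BirchSwinnertonDyer.Theorems

open WeierstrassCurve IsDedekindDomain NumberField
  Literature.NumberTheory.EllipticCurves Literature.NumberTheory.EllipticCurves.ModularForms
  Literature.NumberTheory.EllipticCurves.Rank1Residual
  Summit.BirchSwinnertonDyer.Rank1Residual.ManinAdditive
  Summit.BirchSwinnertonDyer.Rank1Residual.Additive
  Summit.BirchSwinnertonDyer.BirchSwinnertonDyer.Theses.EdixhovenFibreFiveSeven

/-! ### Standalone local corollaries of Mazur's list (reusable outside the line) -/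

section Standalone

variable (W : WeierstrassCurve ℚ) [W.IsElliptic] [W.IsGloballyMinimal] (p : ℕ) [hp : Fact p.Prime]

/-- **A `W[p]`-reducible curve which is additive at a prime `p ≥ 11`, `p ∉ {13, 37}`, is potentially
SUPERSINGULAR at `p`** (not (G)-ordinary), GRANTED Mazur's list (`hJ`): the `j`-invariant is one of
`−2¹⁵, −11², −11·131³` (`p = 11`), `−17²·101³/2, −17·373³/2¹⁷` (`p = 17`), or the CM value of `ℚ(√−p)`
(`p ∈ {19, 43, 67, 163}`), and in each case `j ≡ 0` (with `p ≡ 2 mod 3`) or `j ≡ 1728` (with `p ≡ 3 mod 4`)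
above `p`. Conditional on the cite-only fact only. [cite: Mazur1978, Thm. 1] [cite: SilvermanAEC2009, V.4.1(a)] -/
theorem not_typeGOrd_of_not_hasIrreducibleModPGaloisRep_of_eleven_le
    (hJ : mazur_j_mem_of_not_hasIrreducibleModPGaloisRep_of_eleven_le) (h11 : 11 ≤ p) (h13 : p ≠ 13)
    (h37 : p ≠ 37) (hadd : Addv W p) (hred : ¬ W.HasIrreducibleModPGaloisRep p) : ¬ TypeGOrd W p := by
  have h5 : 5 ≤ p := by omega
  rcases hJ W p h11 h13 hred with ⟨rfl, hj⟩ | ⟨rfl, hj⟩ | ⟨rfl, hj⟩ | ⟨rfl, hj⟩ | ⟨rfl, hj⟩ |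
    ⟨rfl, hj⟩ | ⟨rfl, hj⟩
  · rcases hj with hj | hj | hj
    · refine not_typeGOrd_of_padicValRat_j_sub_pos_of_not_four_dvd W 11 h5 hadd (by norm_num) (Or.inr ?_)
      have h : W.j - 1728 = ((-34496 : ℤ) : ℚ) := by rw [hj]; norm_num
      rw [h]; exact padicValRat_intCast_pos_of_dvd (by norm_num) (by norm_num)
    · refine not_typeGOrd_of_padicValRat_j_pos_of_not_three_dvd W 11 h5 hadd (by norm_num) (Or.inr ?_)
      have h : W.j = ((-121 : ℤ) : ℚ) := by rw [hj]; norm_num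
      rw [h]; exact padicValRat_intCast_pos_of_dvd (by norm_num) (by norm_num)
    · refine not_typeGOrd_of_padicValRat_j_pos_of_not_three_dvd W 11 h5 hadd (by norm_num) (Or.inr ?_)
      have h : W.j = ((-24729001 : ℤ) : ℚ) := by rw [hj]; norm_num
      rw [h]; exact padicValRat_intCast_pos_of_dvd (by norm_num) (by norm_num)
  · rcases hj with hj | hj
    · refine not_typeGOrd_of_padicValRat_j_pos_of_not_three_dvd W 17 h5 hadd (by norm_num) (Or.inr ?_)
      have h : W.j = ((-297756989 : ℤ) : ℚ) / ((2 : ℕ) : ℚ) := by rw [hj]; norm_num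
      rw [h]
      exact padicValRat_intCast_div_natCast_pos_of_dvd (by norm_num) (by norm_num) (by norm_num)
        (by norm_num)
    · refine not_typeGOrd_of_padicValRat_j_pos_of_not_three_dvd W 17 h5 hadd (by norm_num) (Or.inr ?_)
      have h : W.j = ((-882216989 : ℤ) : ℚ) / ((131072 : ℕ) : ℚ) := by rw [hj]; norm_num
      rw [h]
      exact padicValRat_intCast_div_natCast_pos_of_dvd (by norm_num) (by norm_num) (by norm_num)
        (by norm_num)
  · refine not_typeGOrd_of_padicValRat_j_sub_pos_of_not_four_dvd W 19 h5 hadd (by norm_num) (Or.inr ?_)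
    have h : W.j - 1728 = ((-886464 : ℤ) : ℚ) := by rw [hj]; norm_num
    rw [h]; exact padicValRat_intCast_pos_of_dvd (by norm_num) (by norm_num)
  · exact absurd rfl h37
  · refine not_typeGOrd_of_padicValRat_j_sub_pos_of_not_four_dvd W 43 h5 hadd (by norm_num) (Or.inr ?_)
    have h : W.j - 1728 = ((-884737728 : ℤ) : ℚ) := by rw [hj]; norm_num
    rw [h]; exact padicValRat_intCast_pos_of_dvd (by norm_num) (by norm_num)
  · refine not_typeGOrd_of_padicValRat_j_sub_pos_of_not_four_dvd W 67 h5 hadd (by norm_num) (Or.inr ?_)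
    have h : W.j - 1728 = ((-147197953728 : ℤ) : ℚ) := by rw [hj]; norm_num
    rw [h]; exact padicValRat_intCast_pos_of_dvd (by norm_num) (by norm_num)
  · refine not_typeGOrd_of_padicValRat_j_sub_pos_of_not_four_dvd W 163 h5 hadd (by norm_num) (Or.inr ?_)
    have h : W.j - 1728 = ((-262537412640769728 : ℤ) : ℚ) := by rw [hj]; norm_num
    rw [h]; exact padicValRat_intCast_pos_of_dvd (by norm_num) (by norm_num)

omit hp in
/-- **A `W[37]`-reducible curve which is additive at `37` has a STARRED fibre there** (`ord₃₇ Δ_min > 4`;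
with `6 ∣ ord₃₇ Δ_min` it is the `I₀*` twist of a good curve), GRANTED Mazur's list (`hJ`): `j ∈ {−7·11³,
−7·137³·2083³}` are `37`-adic units with `j − 1728` a `37`-adic unit. In particular such a curve is never
globally twist-minimal of Kodaira type II/III/IV at `37`. [cite: Mazur1978, Thm. 1] [cite: SilvermanATAEC1994, IV Table 4.1] -/
theorem four_lt_padicValInt_of_not_hasIrreducibleModPGaloisRep_thirtySeven [Fact (37 : ℕ).Prime]
    (hJ : mazur_j_mem_of_not_hasIrreducibleModPGaloisRep_of_eleven_le) (hadd : Addv W 37)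
    (hred : ¬ W.HasIrreducibleModPGaloisRep 37) : 4 < padicValInt 37 W.minimalDiscriminantInt := by
  rcases hJ W 37 (by norm_num) (by norm_num) hred with ⟨h, -⟩ | ⟨h, -⟩ | ⟨h, -⟩ | ⟨-, hj⟩ | ⟨h, -⟩ |
    ⟨h, -⟩ | ⟨h, -⟩
  all_goals try (exact absurd h (by norm_num))
  have hv : padicValRat 37 W.j = 0 ∧ padicValRat 37 (W.j - 1728) = 0 ∧ W.j ≠ 0 ∧ W.j ≠ 1728 := by
    rcases hj with hj | hj
    · have h : W.j = ((-9317 : ℤ) : ℚ) := by rw [hj]; norm_num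
      have h' : W.j - 1728 = ((-11045 : ℤ) : ℚ) := by rw [hj]; norm_num
      exact ⟨by rw [h]; exact padicValRat_intCast_eq_zero_of_not_dvd (by norm_num),
        by rw [h']; exact padicValRat_intCast_eq_zero_of_not_dvd (by norm_num),
        by rw [hj]; norm_num, by rw [hj]; norm_num⟩
    · have h : W.j = ((-162677523113838677 : ℤ) : ℚ) := by rw [hj]; norm_num
      have h' : W.j - 1728 = ((-162677523113840405 : ℤ) : ℚ) := by rw [hj]; norm_num
      exact ⟨by rw [h]; exact padicValRat_intCast_eq_zero_of_not_dvd (by norm_num),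
        by rw [h']; exact padicValRat_intCast_eq_zero_of_not_dvd (by norm_num),
        by rw [hj]; norm_num, by rw [hj]; norm_num⟩
  obtain ⟨hv0, hv1, hj0, hj1728⟩ := hv
  exact four_lt_padicValInt_of_padicValRat_j_eq_zero_of_padicValRat_j_sub_eq_zero W 37 (by norm_num) hadd
    hj0 hv0 hj1728 hv1

end Standalone

/-- **Core RED(13) ⟸ RED(13♯) (`N > 5·10⁵`), GRANTED Cremona's table** (cite-only fact `h500k`:
`|c| = 1` for every lattice-optimal datum of level `≤ 500000`; a prime divides `c` only if it divides
`|c| = 1`). RED(13) is hypothesis `h13` of `coreRED11_of_mazurJ_of_coreRED13` VERBATIM; RED(13♯) appends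
`500000 < W.conductorNorm ℤ` as the LAST binder (after `p ∣ D.modularDegree`; the width seat's convention for RED57♯). Conditional-result.
[cite: CesnaviciusNeururerSaha2023, §1 p. 2 and ref. [Cre22]] [cite: Cremona2022ManinConstants, ¶ "Concerning the Manin constant"] -/
theorem coreRED13_of_cremona_of_coreRED13sharp
    (h500k : cremona_abs_maninConstant_eq_one_of_level_le_500000)
    (h13s : mazur_not_dvd_maninConstant_of_odd → abbesUllmo_not_dvd_maninConstant_of_not_dvd_level →
      cesnavicius_not_two_dvd_maninConstant_of_two_dvd_level → exists_isNewformOf →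
      ∀ (W : WeierstrassCurve ℚ) [W.IsElliptic] [W.IsGloballyMinimal] [NeZero (W.conductorNorm ℤ)]
        (D : ModularParametrizationData W (W.conductorNorm ℤ)),
        IsLatticeOptimal D → ∀ p : ℕ, p.Prime → p = 13 → p ^ 2 ∣ W.conductorNorm ℤ →
        ¬ (∃ (W' : WeierstrassCurve ℚ) (q : ℕ), W'.IsElliptic ∧ W'.IsGloballyMinimal ∧ q.Prime ∧
            q ≠ 2 ∧ q ^ 2 ∣ W.conductorNorm ℤ ∧
            IsIsogenous W (W'.quadraticTwist (((-1 : ℤ) ^ (q / 2) * q : ℤ) : ℚ)) ∧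
            ¬ q ^ 2 ∣ W'.conductorNorm ℤ) →
        ¬ (∃ (W' : WeierstrassCurve ℚ) (d : ℤ), W'.IsElliptic ∧ W'.IsGloballyMinimal ∧
            (d = -1 ∨ d = 2 ∨ d = -2) ∧ 2 ^ 2 ∣ W.conductorNorm ℤ ∧
            IsIsogenous W (W'.quadraticTwist (d : ℚ)) ∧ ¬ 2 ^ 2 ∣ W'.conductorNorm ℤ) →
        ¬ W.HasIrreducibleModPGaloisRep p →
        padicValInt p W.minimalDiscriminantInt ≤ 4 →
        (∃ (L : Type) (_ : Field L) (_ : NumberField L) (_ : IsCyclotomicExtension {p} ℚ L)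
            (F : IntermediateField ℚ L),
            ∀ w : HeightOneSpectrum (𝓞 F), (p : 𝓞 F) ∈ w.asIdeal →
              (W.baseChange F).HasGoodReductionAt w ∧ (W.baseChange F).HasUnitRootAt w) →
        p ∣ D.modularDegree →
        500000 < W.conductorNorm ℤ →
        ¬ (p : ℤ) ∣ D.maninConstant) :
    mazur_not_dvd_maninConstant_of_odd → abbesUllmo_not_dvd_maninConstant_of_not_dvd_level →
    cesnavicius_not_two_dvd_maninConstant_of_two_dvd_level → exists_isNewformOf →
    ∀ (W : WeierstrassCurve ℚ) [W.IsElliptic] [W.IsGloballyMinimal] [NeZero (W.conductorNorm ℤ)]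
      (D : ModularParametrizationData W (W.conductorNorm ℤ)),
      IsLatticeOptimal D → ∀ p : ℕ, p.Prime → p = 13 → p ^ 2 ∣ W.conductorNorm ℤ →
      ¬ (∃ (W' : WeierstrassCurve ℚ) (q : ℕ), W'.IsElliptic ∧ W'.IsGloballyMinimal ∧ q.Prime ∧
          q ≠ 2 ∧ q ^ 2 ∣ W.conductorNorm ℤ ∧
          IsIsogenous W (W'.quadraticTwist (((-1 : ℤ) ^ (q / 2) * q : ℤ) : ℚ)) ∧
          ¬ q ^ 2 ∣ W'.conductorNorm ℤ) →
      ¬ (∃ (W' : WeierstrassCurve ℚ) (d : ℤ), W'.IsElliptic ∧ W'.IsGloballyMinimal ∧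
          (d = -1 ∨ d = 2 ∨ d = -2) ∧ 2 ^ 2 ∣ W.conductorNorm ℤ ∧
          IsIsogenous W (W'.quadraticTwist (d : ℚ)) ∧ ¬ 2 ^ 2 ∣ W'.conductorNorm ℤ) →
      ¬ W.HasIrreducibleModPGaloisRep p →
      padicValInt p W.minimalDiscriminantInt ≤ 4 →
      (∃ (L : Type) (_ : Field L) (_ : NumberField L) (_ : IsCyclotomicExtension {p} ℚ L)
          (F : IntermediateField ℚ L),
          ∀ w : HeightOneSpectrum (𝓞 F), (p : 𝓞 F) ∈ w.asIdeal →
            (W.baseChange F).HasGoodReductionAt w ∧ (W.baseChange F).HasUnitRootAt w) →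
      p ∣ D.modularDegree →
      ¬ (p : ℤ) ∣ D.maninConstant := by
  intro hM hAU hC hnf W _ _ _ D hD p hp hp13 hpN hodd hdy hred hlow hGo hdeg
  by_cases hN : W.conductorNorm ℤ ≤ 500000
  · -- Cremona's range: `|c| = 1`
    have h1 : |D.maninConstant| = 1 := h500k W D hD hN
    intro hdvd
    have h1' : (p : ℤ) ∣ 1 := by
      rw [← h1]
      exact (dvd_abs _ _).mpr hdvd
    have hp1 : (p : ℤ) = 1 := Int.eq_one_of_dvd_one (by positivity) h1'
    exact hp.one_lt.ne' (by exact_mod_cast hp1)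
  · exact h13s hM hAU hC hnf W D hD p hp hp13 hpN hodd hdy hred hlow hGo hdeg (lt_of_not_ge hN)

/-- **STUB 2 `stub_reducibleTwistMinimal` of line `upper_anchor` (registered signature VERBATIM as the
conclusion) ⟸ Edixhoven 1991 Thm. 3 (`hK`, `hG`) ∧ ČNS Thm. 1.2 (`hCNS`) ∧ Cremona ≤ 5·10⁵ (`h500k`) ∧
Mazur's list (`hJ`) ∧ core RED(57) (`h57`) ∧ core RED(13♯) (`h13s`).** The width seat's
`reducibleTwistMinimal_of_edixhoven_cns_of_cores` with its core RED(11) discharged down to `p = 13` by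
`coreRED11_of_mazurJ_of_coreRED13` and to `N > 5·10⁵` by `coreRED13_of_cremona_of_coreRED13sharp`.
Conditional-result. [cite: EdixhovenManin1991, Thm. 3] [cite: CesnaviciusNeururerSaha2023, Thm. 1.2]
[cite: Mazur1978, Thm. 1] -/
theorem reducibleTwistMinimal_of_print_mazurJ_of_cores
    (hK : edixhoven_not_dvd_maninConstant_of_kodairaSymbol_ne)
    (hG : edixhoven_not_dvd_maninConstant_of_not_potentiallyGoodOrdinary)
    (hCNS : cesnaviciusNeururerSaha_padicVal_maninConstant_le_modularDegree)
    (h500k : cremona_abs_maninConstant_eq_one_of_level_le_500000)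
    (hJ : mazur_j_mem_of_not_hasIrreducibleModPGaloisRep_of_eleven_le)
    (h57 : mazur_not_dvd_maninConstant_of_odd → abbesUllmo_not_dvd_maninConstant_of_not_dvd_level →
      cesnavicius_not_two_dvd_maninConstant_of_two_dvd_level → exists_isNewformOf →
      ∀ (W : WeierstrassCurve ℚ) [W.IsElliptic] [W.IsGloballyMinimal] [NeZero (W.conductorNorm ℤ)]
        (D : ModularParametrizationData W (W.conductorNorm ℤ)),
        IsLatticeOptimal D → ∀ p : ℕ, p.Prime → (p = 5 ∨ p = 7) → p ^ 2 ∣ W.conductorNorm ℤ →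
        ¬ (∃ (W' : WeierstrassCurve ℚ) (q : ℕ), W'.IsElliptic ∧ W'.IsGloballyMinimal ∧ q.Prime ∧
            q ≠ 2 ∧ q ^ 2 ∣ W.conductorNorm ℤ ∧
            IsIsogenous W (W'.quadraticTwist (((-1 : ℤ) ^ (q / 2) * q : ℤ) : ℚ)) ∧
            ¬ q ^ 2 ∣ W'.conductorNorm ℤ) →
        ¬ (∃ (W' : WeierstrassCurve ℚ) (d : ℤ), W'.IsElliptic ∧ W'.IsGloballyMinimal ∧
            (d = -1 ∨ d = 2 ∨ d = -2) ∧ 2 ^ 2 ∣ W.conductorNorm ℤ ∧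
            IsIsogenous W (W'.quadraticTwist (d : ℚ)) ∧ ¬ 2 ^ 2 ∣ W'.conductorNorm ℤ) →
        ¬ W.HasIrreducibleModPGaloisRep p →
        ¬ (p : ℤ) ∣ D.maninConstant)
    (h13s : mazur_not_dvd_maninConstant_of_odd → abbesUllmo_not_dvd_maninConstant_of_not_dvd_level →
      cesnavicius_not_two_dvd_maninConstant_of_two_dvd_level → exists_isNewformOf →
      ∀ (W : WeierstrassCurve ℚ) [W.IsElliptic] [W.IsGloballyMinimal] [NeZero (W.conductorNorm ℤ)]
        (D : ModularParametrizationData W (W.conductorNorm ℤ)),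
        IsLatticeOptimal D → ∀ p : ℕ, p.Prime → p = 13 → p ^ 2 ∣ W.conductorNorm ℤ →
        ¬ (∃ (W' : WeierstrassCurve ℚ) (q : ℕ), W'.IsElliptic ∧ W'.IsGloballyMinimal ∧ q.Prime ∧
            q ≠ 2 ∧ q ^ 2 ∣ W.conductorNorm ℤ ∧
            IsIsogenous W (W'.quadraticTwist (((-1 : ℤ) ^ (q / 2) * q : ℤ) : ℚ)) ∧
            ¬ q ^ 2 ∣ W'.conductorNorm ℤ) →
        ¬ (∃ (W' : WeierstrassCurve ℚ) (d : ℤ), W'.IsElliptic ∧ W'.IsGloballyMinimal ∧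
            (d = -1 ∨ d = 2 ∨ d = -2) ∧ 2 ^ 2 ∣ W.conductorNorm ℤ ∧
            IsIsogenous W (W'.quadraticTwist (d : ℚ)) ∧ ¬ 2 ^ 2 ∣ W'.conductorNorm ℤ) →
        ¬ W.HasIrreducibleModPGaloisRep p →
        padicValInt p W.minimalDiscriminantInt ≤ 4 →
        (∃ (L : Type) (_ : Field L) (_ : NumberField L) (_ : IsCyclotomicExtension {p} ℚ L)
            (F : IntermediateField ℚ L),
            ∀ w : HeightOneSpectrum (𝓞 F), (p : 𝓞 F) ∈ w.asIdeal →
              (W.baseChange F).HasGoodReductionAt w ∧ (W.baseChange F).HasUnitRootAt w) →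
        p ∣ D.modularDegree →
        500000 < W.conductorNorm ℤ →
        ¬ (p : ℤ) ∣ D.maninConstant) :
    mazur_not_dvd_maninConstant_of_odd → abbesUllmo_not_dvd_maninConstant_of_not_dvd_level →
    cesnavicius_not_two_dvd_maninConstant_of_two_dvd_level → exists_isNewformOf →
    ∀ (W : WeierstrassCurve ℚ) [W.IsElliptic] [W.IsGloballyMinimal] [NeZero (W.conductorNorm ℤ)]
      (D : ModularParametrizationData W (W.conductorNorm ℤ)),
      IsLatticeOptimal D → ∀ p : ℕ, p.Prime → 5 ≤ p → p ^ 2 ∣ W.conductorNorm ℤ →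
      ¬ (∃ (W' : WeierstrassCurve ℚ) (q : ℕ), W'.IsElliptic ∧ W'.IsGloballyMinimal ∧ q.Prime ∧
          q ≠ 2 ∧ q ^ 2 ∣ W.conductorNorm ℤ ∧
          IsIsogenous W (W'.quadraticTwist (((-1 : ℤ) ^ (q / 2) * q : ℤ) : ℚ)) ∧
          ¬ q ^ 2 ∣ W'.conductorNorm ℤ) →
      ¬ (∃ (W' : WeierstrassCurve ℚ) (d : ℤ), W'.IsElliptic ∧ W'.IsGloballyMinimal ∧
          (d = -1 ∨ d = 2 ∨ d = -2) ∧ 2 ^ 2 ∣ W.conductorNorm ℤ ∧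
          IsIsogenous W (W'.quadraticTwist (d : ℚ)) ∧ ¬ 2 ^ 2 ∣ W'.conductorNorm ℤ) →
      ¬ W.HasIrreducibleModPGaloisRep p →
      ¬ (p : ℤ) ∣ D.maninConstant :=
  reducibleTwistMinimal_of_edixhoven_cns_of_cores hK hG hCNS h57
    (coreRED11_of_mazurJ_of_coreRED13 hJ (coreRED13_of_cremona_of_coreRED13sharp h500k h13s))

/-- **C5 `ManinPrimeToAdditiveFiveLe` BY NAME ⟸ seven printed facts + KP57 + RED(57) + RED(13♯)** — the
line `upper_anchor`'s ledger after this file (conditional-result; C5 is NOT proved): Kato F′ (`hK`), Kato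
F″ (`hK57`), ČNS Thm. 1.2 (`hCNS`), Cremona ≤ 5·10⁵ (`h500k`), the registered crux KP57 BY NAME (`hKP57`,
stmt-BirchSwinnertonDyer-23810), Edixhoven Thm. 3 Kodaira half (`hEdK`) and ordinarity half (`hEdG`),
Mazur's list (`hJ`); open cores RED(57) (`h57`: `p ∈ {5, 7}`, `W[p]` reducible, globally twist-minimal)
and RED(13♯) (`h13s`: `p = 13`, `W[13]` reducible, globally twist-minimal, Kodaira II/III/IV at `13`,
potentially good ordinary, `13 ∣ deg φ`, `N > 5·10⁵`). `maninPrimeToAdditiveFiveLe_of_print_mazurJ_of_kp57_of_cores`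
with its RED(13) cut to RED(13♯) by `coreRED13_of_cremona_of_coreRED13sharp`.
[cite: Mazur1978, Thm. 1] [cite: EdixhovenManin1991, Thm. 3] [cite: CesnaviciusNeururerSaha2023, Thm. 1.2]
[cite: Kato2004Asterisque, (8.1.3) (p. 180), Thm. 9.7 (p. 189)] [cite: KostersPannekoek2017, Thm. 1 and Cor. 2] -/
theorem maninPrimeToAdditiveFiveLe_of_print_mazurJ_of_kp57_of_cores_sharp
    (hK : kato_neron_isIntegral_twistedSymbolSum_of_additive)
    (hK57 : kato_neron_isIntegral_twistedSymbolSum_of_additive_five_le)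
    (hCNS : cesnaviciusNeururerSaha_padicVal_maninConstant_le_modularDegree)
    (h500k : cremona_abs_maninConstant_eq_one_of_level_le_500000)
    (hKP57 : KPResidueManinUnitFiveSeven)
    (hEdK : edixhoven_not_dvd_maninConstant_of_kodairaSymbol_ne)
    (hEdG : edixhoven_not_dvd_maninConstant_of_not_potentiallyGoodOrdinary)
    (hJ : mazur_j_mem_of_not_hasIrreducibleModPGaloisRep_of_eleven_le)
    (h57 : mazur_not_dvd_maninConstant_of_odd → abbesUllmo_not_dvd_maninConstant_of_not_dvd_level →
      cesnavicius_not_two_dvd_maninConstant_of_two_dvd_level → exists_isNewformOf →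
      ∀ (W : WeierstrassCurve ℚ) [W.IsElliptic] [W.IsGloballyMinimal] [NeZero (W.conductorNorm ℤ)]
        (D : ModularParametrizationData W (W.conductorNorm ℤ)),
        IsLatticeOptimal D → ∀ p : ℕ, p.Prime → (p = 5 ∨ p = 7) → p ^ 2 ∣ W.conductorNorm ℤ →
        ¬ (∃ (W' : WeierstrassCurve ℚ) (q : ℕ), W'.IsElliptic ∧ W'.IsGloballyMinimal ∧ q.Prime ∧
            q ≠ 2 ∧ q ^ 2 ∣ W.conductorNorm ℤ ∧
            IsIsogenous W (W'.quadraticTwist (((-1 : ℤ) ^ (q / 2) * q : ℤ) : ℚ)) ∧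
            ¬ q ^ 2 ∣ W'.conductorNorm ℤ) →
        ¬ (∃ (W' : WeierstrassCurve ℚ) (d : ℤ), W'.IsElliptic ∧ W'.IsGloballyMinimal ∧
            (d = -1 ∨ d = 2 ∨ d = -2) ∧ 2 ^ 2 ∣ W.conductorNorm ℤ ∧
            IsIsogenous W (W'.quadraticTwist (d : ℚ)) ∧ ¬ 2 ^ 2 ∣ W'.conductorNorm ℤ) →
        ¬ W.HasIrreducibleModPGaloisRep p →
        ¬ (p : ℤ) ∣ D.maninConstant)
    (h13s : mazur_not_dvd_maninConstant_of_odd → abbesUllmo_not_dvd_maninConstant_of_not_dvd_level →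
      cesnavicius_not_two_dvd_maninConstant_of_two_dvd_level → exists_isNewformOf →
      ∀ (W : WeierstrassCurve ℚ) [W.IsElliptic] [W.IsGloballyMinimal] [NeZero (W.conductorNorm ℤ)]
        (D : ModularParametrizationData W (W.conductorNorm ℤ)),
        IsLatticeOptimal D → ∀ p : ℕ, p.Prime → p = 13 → p ^ 2 ∣ W.conductorNorm ℤ →
        ¬ (∃ (W' : WeierstrassCurve ℚ) (q : ℕ), W'.IsElliptic ∧ W'.IsGloballyMinimal ∧ q.Prime ∧
            q ≠ 2 ∧ q ^ 2 ∣ W.conductorNorm ℤ ∧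
            IsIsogenous W (W'.quadraticTwist (((-1 : ℤ) ^ (q / 2) * q : ℤ) : ℚ)) ∧
            ¬ q ^ 2 ∣ W'.conductorNorm ℤ) →
        ¬ (∃ (W' : WeierstrassCurve ℚ) (d : ℤ), W'.IsElliptic ∧ W'.IsGloballyMinimal ∧
            (d = -1 ∨ d = 2 ∨ d = -2) ∧ 2 ^ 2 ∣ W.conductorNorm ℤ ∧
            IsIsogenous W (W'.quadraticTwist (d : ℚ)) ∧ ¬ 2 ^ 2 ∣ W'.conductorNorm ℤ) →
        ¬ W.HasIrreducibleModPGaloisRep p →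
        padicValInt p W.minimalDiscriminantInt ≤ 4 →
        (∃ (L : Type) (_ : Field L) (_ : NumberField L) (_ : IsCyclotomicExtension {p} ℚ L)
            (F : IntermediateField ℚ L),
            ∀ w : HeightOneSpectrum (𝓞 F), (p : 𝓞 F) ∈ w.asIdeal →
              (W.baseChange F).HasGoodReductionAt w ∧ (W.baseChange F).HasUnitRootAt w) →
        p ∣ D.modularDegree →
        500000 < W.conductorNorm ℤ →
        ¬ (p : ℤ) ∣ D.maninConstant) :
    Summit.BirchSwinnertonDyer.BirchSwinnertonDyer.Theses.ManinLocalTwoThree.ManinPrimeToAdditiveFiveLe :=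
  maninPrimeToAdditiveFiveLe_of_print_mazurJ_of_kp57_of_cores hK hK57 hCNS h500k hKP57 hEdK hEdG hJ h57
    (coreRED13_of_cremona_of_coreRED13sharp h500k h13s)

end Summit.BirchSwinnertonDyer.BirchSwinnertonDyer.Theorems

end
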